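import Literature.NumberTheory.Automorphic.SymplecticSatakeWeylInvariance
import Literature.NumberTheory.Automorphic.SymplecticSatakeInjective
import Literature.NumberTheory.Automorphic.SymplecticCartanIwasawaUniqueness
import Literature.NumberTheory.Automorphic.HyperspecialUnitarySatakeIsomorphism
import HarnessLib

/-!
# The Satake isomorphism for `Sp_{2n}` in every rank: `𝒮_q : ℋ(Sp_{2n}(K), Sp_{2n}(𝒪); R) ⥲ R[ℤⁿ]^{W(C_n)}` for every
# commutative ring `R` in which the residue cardinality `q` is a unit (Satake 1963 §7; Cartier 1979 §IV Thm. 4.1;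
# Andrianov–Zhuravlev Thm. 3.30)

Topic `NumberTheory/Automorphic`; namespace `Literature.NumberTheory.Automorphic.SymplecticCartan` (lane `lit-hodgefound`,
Track 2 foundations; seat `lit-hodgefound-p11`, generation 50, row g50-#6).  DEFINITIONS with bodies (`dominantBelow`,
`symplecticSatakeAlgEquiv`) + theorems; no named fact, no instance, no notation.  Assembles `SymplecticSatakeWeylInvariance`
(g50-#5: `𝒮_q(ℋ_R) ⊆ R[ℤⁿ]^{W(C_n)}`), the tree's injectivity over every commutative ring
(`symplecticSatakeTransform_injective_of_commRing`, g44), its triangularity (`headSum_le_of_coeff_symplecticSatakeTransform_ne_zero`)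
and its unit leading coefficient (`coeff_self_symplecticSatakeTransform_cartanDiagonal`: the coefficient of `x^a` in
`𝒮_q(T_{d(a)})` is `q^{⟨ρ, a⟩}`).

## The mathematics

`G = Sp_{2n}(K)`, `K₀ = Sp_{2n}(𝒪)` (compact `𝒪`, residue cardinality `q`), `W = W(C_n)` the signed permutations of `ℤⁿ`.
The `W`-orbits of `ℤⁿ` are represented by the DOMINANT cocharacters `a_0 ≥ a_1 ≥ ⋯ ≥ a_{n-1} ≥ 0` (`P⁺⁺` of
[CartierCorvallis1979] §IV.4; for the Borel of the tree, `d(a) = diag(ϖ^a; ϖ^{-a})` are the Cartan representatives).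
THEOREM ([Satake1963] §7; [CartierCorvallis1979] Thm. 4.1 «The Satake transform is an isomorphism of `H(G, K)` onto
`ℂ[X_*(A)]^W`»; [AndrianovZhuravlev1995] Ch. 3 Thm. 3.30): for every commutative ring `R` and unit `q ∈ Rˣ` equal to the residue
cardinality, **`𝒮_q : ℋ_R(G, K₀) ⥲ R[ℤⁿ]^W` is an isomorphism of `R`-algebras** (`symplecticSatakeAlgEquiv`; e.g.
`R = ℤ[1/q]`, `𝔽_ℓ` with `ℓ ∤ q`, `ℂ` — Gross's «`H_G ⊗ ℤ[q⁻¹] ≅ R(Ĝ) ⊗ ℤ[q⁻¹]`» for the simply connected group `Sp_{2n}`,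
where `δ^{1/2}` takes values in `q^ℤ`).  PROOF of surjectivity (Cartier's (c)): for `0 ≠ f ∈ R[ℤⁿ]^W` let `a ∈ supp f` have the
lexicographically largest head-sum vector `(Σ_{i≤r} a_i)_r`; by `W`-stability of `supp f`, `a` is dominant (a sign flip at a
negative coordinate, or a transposition at an ascent, would increase the head-sum vector); `F = 𝒮_q(T_{d(a)}) ∈ R[ℤⁿ]^W` has
`F_a = q^{⟨ρ,a⟩} ∈ Rˣ` and is supported on `μ ≤_dom a` (head sums); `g = f - (f_a/F_a) F` is `W`-invariant with `g_a = 0` and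
the finite set `U(g) ⊊ U(f)` of dominant exponents below a dominant exponent of the support strictly decreases; induct.

## What is formalised

* §1 `signFlipAt`/`sign_flip_apply…`, **`antitone_nonneg_of_isMaxOn_headSumVec`** (a head-sum maximal element of a
  `W(C_n)`-stable finite set is dominant).
* §2 `finite_setOf_antitone_nonneg_headSum_le`, **`dominantBelow f`** (`U(f)`), `finite_dominantBelow`.
* §3 **`exists_symplecticSatakeTransform_eq`** (SURJECTIVITY onto `R[ℤⁿ]^W`), **`range_symplecticSatakeTransform_eq_weylInvariants`**,
  **`symplecticSatakeAlgEquiv : ℋ_R(Sp_{2n}(K), Sp_{2n}(𝒪)) ≃ₐ[R] R[ℤⁿ]^{W(C_n)}`**, `coe_symplecticSatakeAlgEquiv`,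
  `symplecticSatakeAlgEquiv_symm_apply_symplecticSatakeTransform`.

## References
* [Satake1963] I. Satake, *Theory of spherical functions on reductive algebraic groups over 𝔭-adic fields*, Publ. Math. IHÉS 18
  (1963), §6 Thm. 7, §7.
* [CartierCorvallis1979] P. Cartier, *Representations of 𝔭-adic groups: a survey*, PSPM 33.1 (1979), §IV (4.2), Thm. 4.1 and its
  proof (b), (c); §IV.4.
* [AndrianovZhuravlev1995] A. N. Andrianov, V. G. Zhuravlev, *Modular Forms and Hecke Operators*, Transl. Math. Monogr. 145
  (1995), Ch. 3 §3.3 Thm. 3.30.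
* [GrossSatake1998] B. H. Gross, *On the Satake isomorphism* (1998), §3 (integrality: `ℤ[q^{±1/2}]`, and `ℤ[q⁻¹]` when `ρ` is integral).
* [BruhatTits1972] F. Bruhat, J. Tits, *Groupes réductifs sur un corps local I*, Publ. Math. IHÉS 41 (1972), Prop. (4.4.4).
-/

noncomputable section

open scoped Valued WithZero MatrixGroups
open Matrix MonoidAlgebra Representation

namespace Literature.NumberTheory.Automorphic.SymplecticCartan

open Literature.NumberTheory.Automorphic Literature.NumberTheory.Automorphic.CartanUnique
  Literature.NumberTheory.Automorphic.HermitianLattice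

variable {n : ℕ}

/-! ## §1 A head-sum maximal element of a `W(C_n)`-stable finite set is dominant -/

/-- The sign vector flipping the coordinate `k` only. [cite: Satake1963, §7] -/
def signFlipAt (k : Fin n) : Fin n → ℤˣ := Function.update (fun _ => 1) k (-1)

/-- `(signFlipAt k)_k = -1`. [cite: Satake1963, §7] -/
theorem signFlipAt_self (k : Fin n) : signFlipAt k k = -1 := by
  rw [signFlipAt, Function.update_self]

/-- `(signFlipAt k)_i = 1` for `i ≠ k`. [cite: Satake1963, §7] -/
theorem signFlipAt_of_ne {k i : Fin n} (h : i ≠ k) : signFlipAt k i = 1 := by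
  rw [signFlipAt, Function.update_of_ne h]

/-- **A head-sum lexicographically maximal element of a `W(C_n)`-stable finite set `S ⊆ ℤⁿ` is dominant**: antitone and
non-negative (a transposition at an ascent, or a sign flip at a negative coordinate, would increase the head-sum vector).
[cite: CartierCorvallis1979, §IV, proof of Thm. 4.1 (c)] [cite: BruhatTits1972, Prop. (4.4.4)] -/
theorem antitone_nonneg_of_isMaxOn_headSumVec {S : Finset (Fin n → ℤ)}
    (hS : ∀ μ ∈ S, ∀ (ε : Fin n → ℤˣ) (π : Equiv.Perm (Fin n)), (fun i => (ε i : ℤ) * μ (π i)) ∈ S) {a : Fin n → ℤ} (ha : a ∈ S)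
    (hmax : ∀ b ∈ S, toLex (headSumVec b) ≤ toLex (headSumVec a)) : Antitone a ∧ ∀ i, 0 ≤ a i := by
  constructor
  · -- antitone: otherwise swap an ascent `a i < a j`, `i < j`
    intro i j hij
    by_contra hcon
    rw [not_le] at hcon
    have hne : i ≠ j := fun h => by rw [h] at hcon; exact lt_irrefl _ hcon
    have hlt : (i : ℕ) < (j : ℕ) := lt_of_le_of_ne (Fin.le_iff_val_le_val.1 hij) fun h => hne (Fin.ext h)
    have hb : (fun k => ((1 : ℤˣ) : ℤ) * a (Equiv.swap i j k)) ∈ S := hS a ha (fun _ => 1) (Equiv.swap i j)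
    have hb' : (fun k => ((1 : ℤˣ) : ℤ) * a (Equiv.swap i j k)) = a ∘ Equiv.swap i j := by
      funext k; rw [Units.val_one, one_mul, Function.comp_apply]
    rw [hb'] at hb
    refine absurd (hmax _ hb) (not_le.2 (toLex_headSumVec_lt i (fun r hr => ?_) ?_))
    · exact (headSum_comp_eq_of_forall_lt a _ r fun k hk =>
        Equiv.swap_apply_of_ne_of_ne (fun h => by rw [h] at hk; omega) (fun h => by rw [h] at hk; omega)).symm
    · rw [headSum_succ, headSum_succ, headSum_comp_eq_of_forall_lt a _ _ fun k hk =>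
        Equiv.swap_apply_of_ne_of_ne (fun h => by rw [h] at hk; omega) (fun h => by rw [h] at hk; omega),
        Function.comp_apply, Equiv.swap_apply_left]
      omega
  · -- non-negative: otherwise flip the sign of a negative coordinate
    intro k
    by_contra hcon
    rw [not_le] at hcon
    have hb : (fun i => (signFlipAt k i : ℤ) * a ((1 : Equiv.Perm (Fin n)) i)) ∈ S := hS a ha (signFlipAt k) 1
    simp only [Equiv.Perm.coe_one, id_eq] at hb
    refine absurd (hmax _ hb) (not_le.2 (toLex_headSumVec_lt k (fun r hr => ?_) ?_))
    · refine (Finset.sum_congr rfl fun i _ => ?_).symm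
      split_ifs with hi
      · have hik : i ≠ k := fun h => by rw [h] at hi; omega
        change (signFlipAt k i : ℤ) * a i = a i
        rw [signFlipAt_of_ne hik, Units.val_one, one_mul]
      · rfl
    · rw [headSum_succ, headSum_succ]
      rw [signFlipAt_self, Units.val_neg, Units.val_one, neg_one_mul]
      have heq : headSum (fun i => (signFlipAt k i : ℤ) * a i) k = headSum a k := by
        refine Finset.sum_congr rfl fun i _ => ?_
        split_ifs with hi
        · have hik : i ≠ k := fun h => by rw [h] at hi; omega
          change (signFlipAt k i : ℤ) * a i = a i
          rw [signFlipAt_of_ne hik, Units.val_one, one_mul]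
        · rfl
      rw [heq]
      omega

/-! ## §2 Finitely many dominant exponents below a given one -/

/-- **Finitely many dominant `λ` (antitone, `≥ 0`) lie below `b` in the dominance order** (`0 ≤ λ_i ≤ λ_0 ≤ b_0`).
[cite: CartierCorvallis1979, §IV, proof of Thm. 4.1 (c)] -/
theorem finite_setOf_antitone_nonneg_headSum_le (b : Fin n → ℤ) :
    Set.Finite {la : Fin n → ℤ | Antitone la ∧ (∀ i, 0 ≤ la i) ∧ ∀ r, headSum la r ≤ headSum b r} := by
  rcases Nat.eq_zero_or_pos n with hn | hn
  · subst hn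
    exact Set.Finite.subset (Set.finite_singleton (fun _ => 0)) fun la _ => funext fun i => i.elim0
  · set B := b ⟨0, hn⟩ with hB
    refine Set.Finite.subset (Set.Finite.pi fun _ : Fin n => Set.finite_Icc 0 B) ?_
    rintro la ⟨hmono, hnn, hle⟩
    simp only [Set.mem_pi, Set.mem_univ, Set.mem_Icc, forall_true_left]
    have h0 : la ⟨0, hn⟩ ≤ B := by
      have h := hle 1
      rw [headSum_succ la ⟨0, hn⟩, headSum_succ b ⟨0, hn⟩, show ((⟨0, hn⟩ : Fin n) : ℕ) = 0 from rfl, headSum_zero,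
        headSum_zero, zero_add, zero_add] at h
      exact h
    exact fun i => ⟨hnn i, (hmono (Fin.le_iff_val_le_val.2 (Nat.zero_le _))).trans h0⟩

variable {R : Type*} [CommRing R]

/-- `U(f)`: the dominant exponents lying below (in the dominance order) some dominant exponent of `supp f`.
[cite: CartierCorvallis1979, §IV, proof of Thm. 4.1 (c)] -/
def dominantBelow (f : AddMonoidAlgebra R (Fin n → ℤ)) : Set (Fin n → ℤ) :=
  {la | Antitone la ∧ (∀ i, 0 ≤ la i) ∧ ∃ b : Fin n → ℤ, f.coeff b ≠ 0 ∧ Antitone b ∧ ∀ r, headSum la r ≤ headSum b r}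

/-- `U(f)` is finite. [cite: CartierCorvallis1979, §IV, proof of Thm. 4.1 (c)] -/
theorem finite_dominantBelow (f : AddMonoidAlgebra R (Fin n → ℤ)) : (dominantBelow f).Finite := by
  refine Set.Finite.subset (Set.Finite.biUnion (Finset.finite_toSet f.coeff.support)
    fun b _ => finite_setOf_antitone_nonneg_headSum_le b) ?_
  rintro la ⟨h1, h2, b, hb, -, hle⟩
  exact Set.mem_biUnion (Finsupp.mem_support_iff.2 hb) ⟨h1, h2, hle⟩

/-! ## §3 Surjectivity onto `R[ℤⁿ]^{W(C_n)}` and the Satake isomorphism -/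

/-- A non-negative antitone `a ∈ ℤⁿ` is the cast of the antitone `ℕ`-vector `a.toNat`. [folklore] -/
private theorem toNat_bookkeeping {a : Fin n → ℤ} (ha : Antitone a) (hnn : ∀ i, 0 ≤ a i) :
    Antitone (fun i => (a i).toNat) ∧ (fun i => ((a i).toNat : ℤ)) = a :=
  ⟨fun _ _ hij => Int.toNat_le_toNat (ha hij), funext fun i => Int.toNat_of_nonneg (hnn i)⟩

variable {K : Type*} [Field K] [Valued K ℤᵐ⁰] {ϖ : K} [CompactSpace 𝒪[K]] [Finite 𝓀[K]]

/-- **SURJECTIVITY OF `𝒮_q` ONTO `R[ℤⁿ]^{W(C_n)}`** (Cartier Thm. 4.1, proof (c), over any commutative `R` with `q ∈ Rˣ` the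
residue cardinality): every `W(C_n)`-invariant Laurent polynomial is the transform of a Hecke operator — induction on `#U(f)`,
subtracting `(f_a / q^{⟨ρ,a⟩}) 𝒮_q(T_{d(a)})` for the head-sum-maximal (hence dominant) exponent `a ∈ supp f`.
[cite: CartierCorvallis1979, §IV Thm. 4.1 and its proof (c)] [cite: Satake1963, §7] [cite: AndrianovZhuravlev1995, Ch. 3 §3.3 Thm. 3.30] -/
theorem exists_symplecticSatakeTransform_eq (hϖ : Valued.v ϖ = WithZero.exp (-1 : ℤ)) (q : Rˣ) (hq : (q : R) = Nat.card 𝓀[K])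
    (f : AddMonoidAlgebra R (Fin n → ℤ)) (hf : f ∈ weylInvariants R (Fin n → ℤ) (symplecticWeylGroup n)) :
    ∃ T : heckeAlgebra R (symplecticGroup (Fin n) K) (symplecticInt (Fin n) K), symplecticSatakeTransform hϖ q T = f := by
  classical
  haveI := isHeckeTriple_symplecticInt (K := K) (l := Fin n)
  suffices H : ∀ (m : ℕ) (f : AddMonoidAlgebra R (Fin n → ℤ)), f ∈ weylInvariants R (Fin n → ℤ) (symplecticWeylGroup n) →
      (finite_dominantBelow f).toFinset.card = m →
      ∃ T : heckeAlgebra R (symplecticGroup (Fin n) K) (symplecticInt (Fin n) K), symplecticSatakeTransform hϖ q T = f from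
    H _ f hf rfl
  intro m
  induction m using Nat.strong_induction_on with
  | _ m ih =>
  intro f hf hm
  by_cases h0 : f = 0
  · exact ⟨0, by rw [h0, map_zero]⟩
  have hW := (mem_weylInvariants_symplecticWeylGroup_iff f).1 hf
  -- the head-sum-maximal exponent `a ∈ supp f` is dominant
  have hSne : f.coeff.support.Nonempty := by
    rw [Finsupp.support_nonempty_iff, ne_eq, AddMonoidAlgebra.coeff_eq_zero]
    exact h0
  obtain ⟨a, haS, hmax⟩ := f.coeff.support.exists_max_image (fun μ => toLex (headSumVec μ)) hSne
  have haS' : f.coeff a ≠ 0 := Finsupp.mem_support_iff.1 haS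
  have hstab : ∀ μ ∈ f.coeff.support, ∀ (ε : Fin n → ℤˣ) (π : Equiv.Perm (Fin n)), (fun i => (ε i : ℤ) * μ (π i)) ∈ f.coeff.support :=
    fun μ hμ ε π => by
      rw [Finsupp.mem_support_iff] at hμ ⊢
      rwa [hW ε π μ]
  obtain ⟨hmono, hnn⟩ := antitone_nonneg_of_isMaxOn_headSumVec hstab haS hmax
  obtain ⟨hmonoN, haN⟩ := toNat_bookkeeping hmono hnn
  -- the basic operator `T_{d(a)}` and its transform `F = q^{⟨ρ,a⟩} x^a + lower terms`
  set Ta : heckeAlgebra R (symplecticGroup (Fin n) K) (symplecticInt (Fin n) K) :=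
    heckeAlgebra.doubleCosetOperator (symplecticInt (Fin n) K)
      (⟨Matrix.diagonal (Sum.elim (fun i => ϖ ^ (a i).toNat) (fun i => (ϖ ^ (a i).toNat)⁻¹)),
        diagonal_pow_mem_symplecticGroup (CartanUnique.uniformizer_ne_zero hϖ) fun i => (a i).toNat⟩ : symplecticGroup (Fin n) K)
    with hTa
  set F := symplecticSatakeTransform hϖ q Ta with hFdef
  have hcF : F.coeff a = ((q ^ symplecticRhoPairing a : Rˣ) : R) := by
    have h := coeff_self_symplecticSatakeTransform_cartanDiagonal hϖ q hmonoN
    rw [haN] at h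
    exact h
  have htri : ∀ μ, F.coeff μ ≠ 0 → ∀ r, headSum μ r ≤ headSum a r := fun μ hμ r => by
    have h := headSum_le_of_coeff_symplecticSatakeTransform_ne_zero hϖ q hmonoN hμ r
    rw [headSum_eq, headSum_eq]
    refine h.trans (le_of_eq (Finset.sum_congr rfl fun i _ => ?_))
    rw [Int.toNat_of_nonneg (hnn i)]
  have hF : F ∈ weylInvariants R (Fin n → ℤ) (symplecticWeylGroup n) := symplecticSatakeTransform_mem_weylInvariants hϖ q hq Ta
  -- `g = f - (f_a / q^{⟨ρ,a⟩}) F`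
  set k : R := f.coeff a * (((q ^ symplecticRhoPairing a)⁻¹ : Rˣ) : R) with hk
  set g := f - k • F with hgdef
  have hg : g ∈ weylInvariants R (Fin n → ℤ) (symplecticWeylGroup n) := Subalgebra.sub_mem _ hf (Subalgebra.smul_mem _ hF k)
  have hgcoeff : ∀ μ, g.coeff μ = f.coeff μ - k * F.coeff μ := fun μ => by
    rw [hgdef, AddMonoidAlgebra.coeff_sub, AddMonoidAlgebra.coeff_smul, Finsupp.sub_apply, Finsupp.smul_apply, smul_eq_mul]
  have hga : g.coeff a = 0 := by rw [hgcoeff, hk, hcF, mul_assoc, Units.inv_mul, mul_one, sub_self]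
  have hgsupp : ∀ μ, g.coeff μ ≠ 0 → f.coeff μ ≠ 0 ∨ F.coeff μ ≠ 0 := fun μ h => by
    by_contra h'
    rw [not_or, not_ne_iff, not_ne_iff] at h'
    exact h (by rw [hgcoeff, h'.1, h'.2, mul_zero, sub_zero])
  -- `U(g) ⊊ U(f)`
  have hsub : dominantBelow g ⊆ dominantBelow f := by
    rintro la ⟨h1, h2, b, hb, hbm, hle⟩
    rcases hgsupp b hb with hbf | hbF
    · exact ⟨h1, h2, b, hbf, hbm, hle⟩
    · exact ⟨h1, h2, a, haS', hmono, fun r => (hle r).trans (htri b hbF r)⟩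
  have haU : a ∈ dominantBelow f := ⟨hmono, hnn, a, haS', hmono, fun _ => le_rfl⟩
  have haU' : a ∉ dominantBelow g := by
    rintro ⟨-, -, b, hb, -, hle⟩
    have hba : a = b := by
      rcases hgsupp b hb with hbf | hbF
      · exact eq_of_headSum_le_of_toLex_le hle (hmax b (Finsupp.mem_support_iff.2 hbf))
      · exact eq_of_headSum_le_antisymm hle (htri b hbF)
    rw [← hba] at hb
    exact hb hga
  have hlt : (finite_dominantBelow g).toFinset.card < (finite_dominantBelow f).toFinset.card :=
    Finset.card_lt_card (Set.Finite.toFinset_ssubset_toFinset.2 ((Set.ssubset_iff_of_subset hsub).2 ⟨a, haU, haU'⟩))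
  obtain ⟨T', hT'⟩ := ih _ (hm ▸ hlt) g hg rfl
  refine ⟨T' + k • Ta, ?_⟩
  rw [map_add, map_smul, hT', hgdef, sub_add_cancel]

/-- **`range 𝒮_q = R[ℤⁿ]^{W(C_n)}`.** [cite: CartierCorvallis1979, §IV Thm. 4.1] [cite: Satake1963, §7] -/
theorem range_symplecticSatakeTransform_eq_weylInvariants (hϖ : Valued.v ϖ = WithZero.exp (-1 : ℤ)) (q : Rˣ)
    (hq : (q : R) = Nat.card 𝓀[K]) :
    (symplecticSatakeTransform (n := n) (K := K) hϖ q).range = weylInvariants R (Fin n → ℤ) (symplecticWeylGroup n) :=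
  le_antisymm (range_symplecticSatakeTransform_le_weylInvariants hϖ q hq) fun f hf =>
    (AlgHom.mem_range _).2 (exists_symplecticSatakeTransform_eq hϖ q hq f hf)

/-- **THE SATAKE ISOMORPHISM FOR `Sp_{2n}` IN EVERY RANK, OVER EVERY COMMUTATIVE RING `R` WITH `q ∈ Rˣ`**:
`𝒮_q : ℋ_R(Sp_{2n}(K), Sp_{2n}(𝒪)) ⥲ R[ℤⁿ]^{W(C_n)}`, an isomorphism of `R`-algebras onto the invariants of the hyperoctahedral
group (`(q : R) = #𝓀`; compact `𝒪`). [cite: Satake1963, §7] [cite: CartierCorvallis1979, §IV Thm. 4.1]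
[cite: AndrianovZhuravlev1995, Ch. 3 §3.3 Thm. 3.30] [cite: GrossSatake1998, §3] -/
def symplecticSatakeAlgEquiv (hϖ : Valued.v ϖ = WithZero.exp (-1 : ℤ)) (q : Rˣ) (hq : (q : R) = Nat.card 𝓀[K]) :
    heckeAlgebra R (symplecticGroup (Fin n) K) (symplecticInt (Fin n) K) ≃ₐ[R] weylInvariants R (Fin n → ℤ) (symplecticWeylGroup n) :=
  AlgEquiv.ofBijective
    ((symplecticSatakeTransform hϖ q).codRestrict (weylInvariants R (Fin n → ℤ) (symplecticWeylGroup n))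
      fun T => symplecticSatakeTransform_mem_weylInvariants hϖ q hq T)
    ⟨fun T T' h => symplecticSatakeTransform_injective_of_commRing hϖ q (congrArg Subtype.val h),
      fun f => by
        obtain ⟨T, hT⟩ := exists_symplecticSatakeTransform_eq hϖ q hq f.1 f.2
        exact ⟨T, Subtype.ext hT⟩⟩

/-- The Satake isomorphism is the Satake transform. [cite: CartierCorvallis1979, §IV Thm. 4.1] -/
@[simp] theorem coe_symplecticSatakeAlgEquiv (hϖ : Valued.v ϖ = WithZero.exp (-1 : ℤ)) (q : Rˣ) (hq : (q : R) = Nat.card 𝓀[K])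
    (T : heckeAlgebra R (symplecticGroup (Fin n) K) (symplecticInt (Fin n) K)) :
    ((symplecticSatakeAlgEquiv hϖ q hq T : weylInvariants R (Fin n → ℤ) (symplecticWeylGroup n)) : AddMonoidAlgebra R (Fin n → ℤ)) =
      symplecticSatakeTransform hϖ q T := rfl

/-- The inverse isomorphism undoes the transform: `𝒮_q⁻¹(𝒮_q T) = T`. [cite: CartierCorvallis1979, §IV Thm. 4.1] -/
theorem symplecticSatakeAlgEquiv_symm_apply_symplecticSatakeTransform (hϖ : Valued.v ϖ = WithZero.exp (-1 : ℤ)) (q : Rˣ)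
    (hq : (q : R) = Nat.card 𝓀[K]) (T : heckeAlgebra R (symplecticGroup (Fin n) K) (symplecticInt (Fin n) K)) :
    (symplecticSatakeAlgEquiv hϖ q hq).symm ⟨symplecticSatakeTransform hϖ q T, symplecticSatakeTransform_mem_weylInvariants hϖ q hq T⟩ = T :=
  (symplecticSatakeAlgEquiv hϖ q hq).symm_apply_eq.2 (Subtype.ext (coe_symplecticSatakeAlgEquiv hϖ q hq T).symm)

end Literature.NumberTheory.Automorphic.SymplecticCartan

end
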